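import Mathlib

/-!
# (P4) Sliced counting: an approximate subgroup of `GL₂(K)` meeting `SL₂(K)` in `≳ |SL₂(K)|`
# elements has boundedly many determinant values
# (crux `LevelGradedCohnUmans.GradedDesignFamily`, stmt-MatrixMultiplication-7610; negative side,
# line `quadratic-extension-level-one-cell`, unit b2b-lgcu-subfield gen 18)

HONEST FRAMING.  This proves piece (P4) of `structureDichotomy_of_pieces`
(`Negative/SubfieldCellStructure.lean`) verbatim: if `A ⊆ GL₂(K)` is an `M`-approximate subgroup with
`|A| ≤ c₂|K|³` and `|SL₂(K)| ≤ C·|A⁴ ∩ SL₂(K)|`, then `A` has at most `⌈2 C M⁴ c₂⌉` determinant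
values (`|K| ≥ 2`): the translates `a_e·(A⁴ ∩ SL₂)`, one per determinant value `e`, are disjoint
inside `A⁵`, `|A⁵| ≤ M⁴|A|` (Mathlib `IsApproximateSubgroup.card_pow_le`), and
`|SL₂(K)| ≥ |K|²(|K| − 1)` (`card_ker_det_fin_two_ge`, an explicit injection).  One elementary input
of the Lean reduction of `¬S3` (THEOREM F′); NOT summit progress.

Sorry-free. [folklore]
-/

set_option linter.dupNamespace false

open scoped Pointwise

namespace Summit.MatrixMultiplication.MatrixMultiplication.Theorems.GradedDesignFamily.Negative

/-- `|SL₂(K)| = |ker det| ≥ |K|·|K|·(|K| − 1)`, by the injection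
`(b, c, a) ↦ [[a, b], [c, (1 + bc)/a]]`. [folklore] -/
theorem card_ker_det_fin_two_ge (K : Type) [Field K] [Fintype K] [DecidableEq K] :
    Fintype.card K * (Fintype.card K * (Fintype.card K - 1)) ≤
      Nat.card (Matrix.GeneralLinearGroup.det :
        Matrix.GeneralLinearGroup (Fin 2) K →* Kˣ).ker := by
  classical
  have hdet : ∀ t : K × K × Kˣ,
      Matrix.det !![(t.2.2 : K), t.1; t.2.1, (1 + t.1 * t.2.1) * (t.2.2 : K)⁻¹] = 1 := by
    intro t
    have ha : (t.2.2 : K) ≠ 0 := t.2.2.ne_zero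
    rw [Matrix.det_fin_two_of]
    field_simp
    ring
  let F : K × K × Kˣ →
      (Matrix.GeneralLinearGroup.det : Matrix.GeneralLinearGroup (Fin 2) K →* Kˣ).ker :=
    fun t => ⟨Matrix.SpecialLinearGroup.toGL ⟨_, hdet t⟩, by
      rw [MonoidHom.mem_ker]
      exact Matrix.SpecialLinearGroup.coeToGL_det _⟩
  have hF : Function.Injective F := by
    rintro ⟨b, c, a⟩ ⟨b', c', a'⟩ h
    have h' := congrArg (fun s : (Matrix.GeneralLinearGroup.det :
        Matrix.GeneralLinearGroup (Fin 2) K →* Kˣ).ker =>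
      ((s : Matrix.GeneralLinearGroup (Fin 2) K) : Matrix (Fin 2) (Fin 2) K)) h
    simp only [F, Matrix.SpecialLinearGroup.coe_GL_coe_matrix] at h'
    have h00 := congr_fun (congr_fun h' 0) 0
    have h01 := congr_fun (congr_fun h' 0) 1
    have h10 := congr_fun (congr_fun h' 1) 0
    simp only [Matrix.of_apply, Matrix.cons_val', Matrix.cons_val_zero, Matrix.cons_val_one,
      Matrix.cons_val_fin_one] at h00 h01 h10
    rw [h01, h10, Units.ext h00]
  have h := Nat.card_le_card_of_injective F hF
  rwa [Nat.card_prod, Nat.card_prod, Nat.card_eq_fintype_card, Nat.card_eq_fintype_card,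
    Fintype.card_units] at h

/-- **(P4) sliced counting.**  Hypothesis (P4) of `structureDichotomy_of_pieces`, verbatim.
NOT summit progress. [folklore] -/
theorem subfieldCell_slicedCounting :
    ∀ M c₂ C : ℝ, 1 ≤ M → 0 < c₂ → 0 < C → ∃ m₀ Q₆ : ℕ,
      ∀ (K : Type) [Field K] [Fintype K] [DecidableEq K], Q₆ ≤ Fintype.card K →
        ∀ A : Finset (Matrix.GeneralLinearGroup (Fin 2) K),
          IsApproximateSubgroup M (A : Set (Matrix.GeneralLinearGroup (Fin 2) K)) →
          (A.card : ℝ) ≤ c₂ * (Fintype.card K : ℝ) ^ 3 →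
          (Nat.card (Matrix.GeneralLinearGroup.det :
              Matrix.GeneralLinearGroup (Fin 2) K →* Kˣ).ker : ℝ) ≤
            C * ((A ^ 4).filter fun g => Matrix.GeneralLinearGroup.det g = 1).card →
          (A.image Matrix.GeneralLinearGroup.det).card ≤ m₀ := by
  intro M c₂ C hM hc₂ hC
  refine ⟨⌈2 * C * M ^ 4 * c₂⌉₊, 2, ?_⟩
  intro K _ _ _ hQ A happ hhi hker
  classical
  have hQ2 : (2 : ℝ) ≤ (Fintype.card K : ℝ) := by exact_mod_cast hQ
  -- representatives of the determinant values
  have hrep : ∀ e ∈ A.image Matrix.GeneralLinearGroup.det, ∃ a ∈ A,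
      Matrix.GeneralLinearGroup.det a = e := fun e he => by
    simpa only [Finset.mem_image] using he
  choose! rep hrepA hrepdet using hrep
  -- the translates `rep e · (A⁴ ∩ SL₂)` are disjoint inside `A⁵`
  have hcard : (A.image Matrix.GeneralLinearGroup.det).card *
      ((A ^ 4).filter fun g => Matrix.GeneralLinearGroup.det g = 1).card ≤ (A ^ 5).card := by
    rw [← Finset.card_product]
    refine Finset.card_le_card_of_injOn (fun p => rep p.1 * p.2) (fun p hp => ?_) ?_
    · obtain ⟨hp1, hp2⟩ := Finset.mem_product.1 (Finset.mem_coe.1 hp)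
      show rep p.1 * p.2 ∈ A ^ 5
      rw [pow_succ']
      exact Finset.mul_mem_mul (hrepA _ hp1) (Finset.mem_filter.1 hp2).1
    · rintro ⟨e, x⟩ hp ⟨e', x'⟩ hp' h
      obtain ⟨he, hx⟩ := Finset.mem_product.1 (Finset.mem_coe.1 hp)
      obtain ⟨he', hx'⟩ := Finset.mem_product.1 (Finset.mem_coe.1 hp')
      have hd := congrArg Matrix.GeneralLinearGroup.det h
      simp only [map_mul, hrepdet e he, hrepdet e' he', (Finset.mem_filter.1 hx).2,
        (Finset.mem_filter.1 hx').2, mul_one] at hd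
      subst hd
      have hx2 : x = x' := mul_left_cancel h
      rw [hx2]
  -- `|A⁵| ≤ M⁴ |A|`
  have h5 : ((A ^ 5).card : ℝ) ≤ M ^ 4 * A.card := by
    have h := happ.card_pow_le (n := 5)
    norm_num at h
    exact h
  -- `|SL₂(K)| ≥ |K|³ / 2`
  have hkerlo : (Fintype.card K : ℝ) ^ 3 / 2 ≤
      (Nat.card (Matrix.GeneralLinearGroup.det :
        Matrix.GeneralLinearGroup (Fin 2) K →* Kˣ).ker : ℝ) := by
    have h := card_ker_det_fin_two_ge K
    have hK1 : 1 ≤ Fintype.card K := Fintype.card_pos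
    have h' : (Fintype.card K : ℝ) * ((Fintype.card K : ℝ) * ((Fintype.card K : ℝ) - 1)) ≤
        (Nat.card (Matrix.GeneralLinearGroup.det :
          Matrix.GeneralLinearGroup (Fin 2) K →* Kˣ).ker : ℝ) := by
      have := (Nat.cast_le (α := ℝ)).2 h
      push_cast [Nat.cast_sub hK1] at this
      exact this
    nlinarith
  -- conclude
  have hprod : ((A.image Matrix.GeneralLinearGroup.det).card : ℝ) *
      ((A ^ 4).filter fun g => Matrix.GeneralLinearGroup.det g = 1).card ≤
      M ^ 4 * (c₂ * (Fintype.card K : ℝ) ^ 3) := by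
    have h1 : ((A.image Matrix.GeneralLinearGroup.det).card : ℝ) *
        ((A ^ 4).filter fun g => Matrix.GeneralLinearGroup.det g = 1).card ≤ (A ^ 5).card := by
      exact_mod_cast hcard
    have hM4 : (0 : ℝ) ≤ M ^ 4 := by positivity
    nlinarith [mul_le_mul_of_nonneg_left hhi hM4]
  have hA4 : (Fintype.card K : ℝ) ^ 3 / (2 * C) ≤
      (((A ^ 4).filter fun g => Matrix.GeneralLinearGroup.det g = 1).card : ℝ) := by
    rw [div_le_iff₀ (by positivity)]
    nlinarith
  by_contra hnot
  rw [not_le] at hnot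
  have hceil := Nat.le_ceil (2 * C * M ^ 4 * c₂)
  have hd : 2 * C * M ^ 4 * c₂ < ((A.image Matrix.GeneralLinearGroup.det).card : ℝ) :=
    lt_of_le_of_lt hceil (by exact_mod_cast hnot)
  have hQ3 : (0 : ℝ) < (Fintype.card K : ℝ) ^ 3 / (2 * C) := by positivity
  have h1 := mul_lt_mul_of_pos_right hd hQ3
  have h2 : 2 * C * M ^ 4 * c₂ * ((Fintype.card K : ℝ) ^ 3 / (2 * C)) =
      M ^ 4 * (c₂ * (Fintype.card K : ℝ) ^ 3) := by
    field_simp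
  have hdpos : (0 : ℝ) ≤ ((A.image Matrix.GeneralLinearGroup.det).card : ℝ) := Nat.cast_nonneg _
  have h3 := mul_le_mul_of_nonneg_left hA4 hdpos
  linarith

end Summit.MatrixMultiplication.MatrixMultiplication.Theorems.GradedDesignFamily.Negative
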